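import Summits.KontsevichZagierPeriods.KontsevichZagierPeriods.Theorems.K2SymbolChainsClausenPiVanishesDoubling
import Summits.KontsevichZagierPeriods.KontsevichZagierPeriods.Theorems.K2SymbolChainsClausenPiVanishesSheets
import Summits.KontsevichZagierPeriods.KontsevichZagierPeriods.Theses.K2SymbolChains

/-!
# Item ClausenPiVanishes (stmt-KontsevichZagierPeriods-5202): `Cl₂(π) = 0` as a KZ-equivalence

Route KontsevichZagierPeriods/K2SymbolChains, support item ClausenPiVanishes: the two rational
two-dimensional representations `[{1 < u < 4t²/(1+t²)}, 1/((1+t²)u)]` and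
`[{4t²/(1+t²) < u < 1}, 1/((1+t²)u)]` — the positive and negative parts of the unfolded
`∫_{−π}^{π} log|1 − e^{iφ}| dφ = 0` (`t = tan(φ/2)`, `log v = ∫₁^v du/u`) — are `KZ.Equivalent`,
i.e. joined by finitely many instances of Kontsevich–Zagier's rules 1) (additivity) and 2) (change
of variables); rule 3) is not used. This file finishes the doubling chain (the two sheet moves
(S4), (S5) along `s = 2t/(1−t²)` and the combination
`L(4) − L(A) = −S7 + S6 − S4 − S5 − S3 + S1 + S2 ∈ relations`, `ClausenPi.doubling`) and assembles
the item (`clausenPiVanishes_proof`) from `pos_part`, `neg_part`, `exists_X_Y`. Classical content: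
Jensen's formula at `|α| = 1`, i.e. `∫₀^π log sin = −π log 2` by `sin θ = 2 sin(θ/2) cos(θ/2)`.
Sources: M. Kontsevich, D. Zagier, *Periods* (2001), §1.2; J. McKee, C. Smyth, *Around the Unit
Circle* (2021), Ch. 1–2; D. Zagier, *The dilogarithm function* (2007), Ch. I (Clausen function).
[folklore]
-/

noncomputable section

open MeasureTheory Set Filter MvPolynomial
open Literature.ModelTheory.ExponentialFields (IsSemialgebraic tarski_seidenberg_real_holds
  isSemialgebraic_setOf_eval_lt isSemialgebraic_setOf_eval_le isSemialgebraic_setOf_eval_ne_zero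
  isSemialgebraic_setOf_eval_eq_zero isSemialgebraic_univ)
open Literature.NumberTheory.Transcendental
open Literature.NumberTheory.Transcendental.KZ

namespace Summit.KontsevichZagierPeriods.K2SymbolChains

namespace ClausenPi

/-- **(S4)** The inner sheet: `[band {0<|t|<1} 1 (A·B), h/u] − [band σ 1 (4A), (h/2)/u] ∈
relations`, one change of variables (rule 2)) along `(t, u) ↦ (2t/(1 − t²), u)`.
[Kontsevich–Zagier 2001, §1.2, rule 2)] [folklore] -/
theorem sheet_inner (c₁ d₂ : KZ.IntegralRep 2)
    (h1d : c₁.domain = KZlog.band {x : Fin 1 → ℝ | x 0 ≠ 0 ∧ x 0 ^ 2 < 1} (fun _ => 1)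
      (fun x => (1 + x 0 ^ 2) / x 0 ^ 2 * (1 + x 0 ^ 2)))
    (h1i : c₁.integrand = fun z => 1 / (1 + Fin.init z 0 ^ 2) / z (Fin.last 1))
    (hd₂d : d₂.domain = KZlog.band {x : Fin 1 → ℝ | x 0 ≠ 0} (fun _ => 1)
      (fun x => 4 * ((1 + x 0 ^ 2) / x 0 ^ 2)))
    (hd₂i : d₂.integrand = fun z => 1 / (1 + Fin.init z 0 ^ 2) / 2 / z (Fin.last 1)) :
    KZ.of c₁ - KZ.of d₂ ∈ KZ.relations := by
  have hσ₁ : IsSemialgebraic ℚ {x : Fin 1 → ℝ | x 0 ≠ 0 ∧ x 0 ^ 2 < 1} :=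
    isSemialgebraic_ne_zero.inter isSemialgebraic_sq_lt_one
  have hne : ∀ x ∈ {x : Fin 1 → ℝ | x 0 ≠ 0 ∧ x 0 ^ 2 < 1}, 1 - x 0 ^ 2 ≠ 0 := fun x hx => by
    have := hx.2
    linarith
  refine of_sub_of_mem_relations_covLift_one hσ₁ (φ := fun t => 2 * t / (1 - t ^ 2))
    (φ' := fun t => 2 * (1 + t ^ 2) / (1 - t ^ 2) ^ 2) ?_ (fun x hx => hasDerivAt_sheet (hne x hx))
    (fun x hx y hy h => sheet_inj (hne x hx) (hne y hy) ?_ h) image_sheet_inner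
    (v := fun x => (1 + x 0 ^ 2) / x 0 ^ 2 * (1 + x 0 ^ 2))
    (v' := fun x => 4 * ((1 + x 0 ^ 2) / x 0 ^ 2))
    (g := fun x => 1 / (1 + x 0 ^ 2)) (g' := fun x => 1 / (1 + x 0 ^ 2) / 2)
    (fun x hx => four_mul_A_sheet hx.1 (hne x hx)) (fun x hx => h_sheet (hne x hx))
    c₁ d₂ h1d h1i hd₂d hd₂i
  · exact (isSemialgebraicFunOn_aeval_div_aeval hσ₁ (C 2 * X 0) (1 - X 0 ^ 2) fun x hx => by
      simpa using hne x hx).congr fun x _ => by simp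
  · have h1 := hx.2
    have h2 := hy.2
    nlinarith [sq_nonneg (x 0 + y 0)]

/-- **(S5)** The outer sheet: `[band {|t|>1} 1 (A·B), h/u] − [band σ 1 (4A), (h/2)/u] ∈ relations`,
one change of variables (rule 2)) along `(t, u) ↦ (2t/(1 − t²), u)`.
[Kontsevich–Zagier 2001, §1.2, rule 2)] [folklore] -/
theorem sheet_outer (c₂ d₂ : KZ.IntegralRep 2)
    (h2d : c₂.domain = KZlog.band {x : Fin 1 → ℝ | 1 < x 0 ^ 2} (fun _ => 1)
      (fun x => (1 + x 0 ^ 2) / x 0 ^ 2 * (1 + x 0 ^ 2)))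
    (h2i : c₂.integrand = fun z => 1 / (1 + Fin.init z 0 ^ 2) / z (Fin.last 1))
    (hd₂d : d₂.domain = KZlog.band {x : Fin 1 → ℝ | x 0 ≠ 0} (fun _ => 1)
      (fun x => 4 * ((1 + x 0 ^ 2) / x 0 ^ 2)))
    (hd₂i : d₂.integrand = fun z => 1 / (1 + Fin.init z 0 ^ 2) / 2 / z (Fin.last 1)) :
    KZ.of c₂ - KZ.of d₂ ∈ KZ.relations := by
  have hσ₂ : IsSemialgebraic ℚ {x : Fin 1 → ℝ | 1 < x 0 ^ 2} := isSemialgebraic_one_lt_sq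
  have hne : ∀ x ∈ {x : Fin 1 → ℝ | 1 < x 0 ^ 2}, 1 - x 0 ^ 2 ≠ 0 := fun x hx => by
    have : (1 : ℝ) < x 0 ^ 2 := hx
    linarith
  have hne0 : ∀ x ∈ {x : Fin 1 → ℝ | 1 < x 0 ^ 2}, x 0 ≠ 0 := fun x hx h0 => by
    have : (1 : ℝ) < x 0 ^ 2 := hx
    rw [h0] at this
    norm_num at this
  refine of_sub_of_mem_relations_covLift_one hσ₂ (φ := fun t => 2 * t / (1 - t ^ 2))
    (φ' := fun t => 2 * (1 + t ^ 2) / (1 - t ^ 2) ^ 2) ?_ (fun x hx => hasDerivAt_sheet (hne x hx))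
    (fun x hx y hy h => sheet_inj (hne x hx) (hne y hy) ?_ h) image_sheet_outer
    (v := fun x => (1 + x 0 ^ 2) / x 0 ^ 2 * (1 + x 0 ^ 2))
    (v' := fun x => 4 * ((1 + x 0 ^ 2) / x 0 ^ 2))
    (g := fun x => 1 / (1 + x 0 ^ 2)) (g' := fun x => 1 / (1 + x 0 ^ 2) / 2)
    (fun x hx => four_mul_A_sheet (hne0 x hx) (hne x hx)) (fun x hx => h_sheet (hne x hx))
    c₂ d₂ h2d h2i hd₂d hd₂i
  · exact (isSemialgebraicFunOn_aeval_div_aeval hσ₂ (C 2 * X 0) (1 - X 0 ^ 2) fun x hx => by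
      simpa using hne x hx).congr fun x _ => by simp
  · intro h0
    have h1 : (1 : ℝ) < x 0 ^ 2 := hx
    have h2 : (1 : ℝ) < y 0 ^ 2 := hy
    have h3 : (1 : ℝ) < (x 0 * y 0) ^ 2 := by
      rw [mul_pow]
      exact one_lt_mul_of_lt_of_le h1 h2.le
    have h4 : x 0 * y 0 = -1 := by linarith
    rw [h4] at h3
    norm_num at h3

/-- **Jensen at `|α| = 1` as a chain ("doubling").** With `σ = {t ≠ 0}`, `h = 1/(1+t²)`,
`A = (1+t²)/t²` (`= 4/|1 − e(t)|²`): `[band σ 1 4, h/u] − [band σ 1 A, h/u] ∈ KZ.relations`, i.e.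
`∫ h log 4 ∼ ∫ h log A` by finitely many Kontsevich–Zagier moves: with `B = 1 + t²`,
`L(A·B) ∼ L(A) + L(B)` (S1), `L(B) ∼ L(A)` (S2, `t ↦ −1/t`), `L(A·B) = L₁ + L₂` over the two sheets
(S3), each sheet `∼ L(h/2, 4A)` (S4, S5, `s = 2t/(1−t²)`, `4A(s) = A(t)B(t)`), `2 L(h/2, 4A) ∼ L(4A)`
(S6) and `L(4A) ∼ L(4) + L(A)` (S7); hence `L(4) − L(A) = −S7 + S6 − S4 − S5 − S3 + S1 + S2`. This
is the classical proof of `∫₀^π log sin = −π log 2` by `sin θ = 2 sin(θ/2) cos(θ/2)`, read in the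
calculus. [Kontsevich–Zagier 2001, §1.2; McKee–Smyth 2021, Ch. 1 (Jensen)] [folklore] -/
theorem doubling (e a : KZ.IntegralRep 2)
    (hed : e.domain = KZlog.band {x : Fin 1 → ℝ | x 0 ≠ 0} (fun _ => 1) (fun _ => 4))
    (hei : e.integrand = fun z => 1 / (1 + Fin.init z 0 ^ 2) / z (Fin.last 1))
    (had : a.domain = KZlog.band {x : Fin 1 → ℝ | x 0 ≠ 0} (fun _ => 1)
      (fun x => (1 + x 0 ^ 2) / x 0 ^ 2))
    (hai : a.integrand = fun z => 1 / (1 + Fin.init z 0 ^ 2) / z (Fin.last 1)) :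
    KZ.of e - KZ.of a ∈ KZ.relations := by
  have hσ := isSemialgebraic_ne_zero
  have hσm : MeasurableSet {x : Fin 1 → ℝ | x 0 ≠ 0} := IsSemialgebraic.measurableSet_holds hσ
  have hh := isSemialgebraicFunOn_h hσ
  have hA := isSemialgebraicFunOn_A hσ fun _ hx => hx
  have hB := isSemialgebraicFunOn_B hσ
  have h1 := isSemialgebraicFunOn_one hσ
  -- integrability of the monomials on `σ`
  have hiA := integrableOn_h_mul_log_A
  have hiB : IntegrableOn (fun x : Fin 1 → ℝ => 1 / (1 + x 0 ^ 2) * Real.log ((1 + x 0 ^ 2) / 1))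
      {x : Fin 1 → ℝ | x 0 ≠ 0} := by
    simpa only [div_one] using integrable_h_mul_log_B.integrableOn
  have hiAB : IntegrableOn (fun x : Fin 1 → ℝ => 1 / (1 + x 0 ^ 2) *
      Real.log ((1 + x 0 ^ 2) / x 0 ^ 2 * (1 + x 0 ^ 2) / 1)) {x : Fin 1 → ℝ | x 0 ≠ 0} := by
    refine (hiA.add integrable_h_mul_log_B.integrableOn).congr_fun (fun x hx => ?_) hσm
    have hx0 : x 0 ≠ 0 := hx
    have hp : (0 : ℝ) < 1 + x 0 ^ 2 := by positivity
    have hq : (0 : ℝ) < (1 + x 0 ^ 2) / x 0 ^ 2 := by positivity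
    simp only [Pi.add_apply]
    rw [div_one, Real.log_mul hq.ne' hp.ne']
    ring
  have hi4A : IntegrableOn (fun x : Fin 1 → ℝ => 1 / (1 + x 0 ^ 2) *
      Real.log (4 * ((1 + x 0 ^ 2) / x 0 ^ 2) / 1)) {x : Fin 1 → ℝ | x 0 ≠ 0} := by
    refine ((integrable_h.mul_const (Real.log 4)).integrableOn.add hiA).congr_fun
      (fun x hx => ?_) hσm
    have hx0 : x 0 ≠ 0 := hx
    have hq : (0 : ℝ) < (1 + x 0 ^ 2) / x 0 ^ 2 := by positivity
    simp only [Pi.add_apply]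
    rw [div_one, Real.log_mul (by norm_num) hq.ne']
    ring
  have hi4A' : IntegrableOn (fun x : Fin 1 → ℝ => 1 / (1 + x 0 ^ 2) / 2 *
      Real.log (4 * ((1 + x 0 ^ 2) / x 0 ^ 2) / 1)) {x : Fin 1 → ℝ | x 0 ≠ 0} := by
    have h' : IntegrableOn (fun x : Fin 1 → ℝ => 1 / (1 + x 0 ^ 2) *
        Real.log (4 * ((1 + x 0 ^ 2) / x 0 ^ 2) / 1) / 2) {x : Fin 1 → ℝ | x 0 ≠ 0} :=
      hi4A.div_const 2
    refine h'.congr_fun (fun x _ => ?_) hσm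
    ring
  -- the auxiliary representations
  obtain ⟨b, hbd, hbi⟩ := exists_bandRep (g := fun x : Fin 1 → ℝ => 1 / (1 + x 0 ^ 2)) hσ h1 hB hh
    (fun _ _ => one_pos) (fun x _ => one_le_B x) hiB
  obtain ⟨c, hcd, hci⟩ := exists_bandRep (g := fun x : Fin 1 → ℝ => 1 / (1 + x 0 ^ 2)) hσ h1
    (IsSemialgebraicFunOn.mul_holds hA hB) hh (fun _ _ => one_pos)
    (fun x hx => one_le_mul_of_one_le_of_one_le (one_le_A hx) (one_le_B x)) hiAB
  obtain ⟨d, hdd, hdi⟩ := exists_bandRep (g := fun x : Fin 1 → ℝ => 1 / (1 + x 0 ^ 2)) hσ h1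
    (IsSemialgebraicFunOn.mul_holds (isSemialgebraicFunOn_four hσ) hA) hh (fun _ _ => one_pos)
    (fun x hx => one_le_mul_of_one_le_of_one_le (by norm_num) (one_le_A hx)) hi4A
  obtain ⟨d₂, hd₂d, hd₂i⟩ := exists_bandRep (g := fun x : Fin 1 → ℝ => 1 / (1 + x 0 ^ 2) / 2) hσ h1
    (IsSemialgebraicFunOn.mul_holds (isSemialgebraicFunOn_four hσ) hA) (isSemialgebraicFunOn_h_half hσ)
    (fun _ _ => one_pos) (fun x hx => one_le_mul_of_one_le_of_one_le (by norm_num) (one_le_A hx)) hi4A'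
  obtain ⟨c₁, c₂, h1d, h1i, h2d, h2i, hS3⟩ := split_sheets c hcd
  have hS1 := mul_AB c a b hcd hci had hai hbd hbi
  have hS2 := shift b a hbd hbi had hai
  have hS4 := sheet_inner c₁ d₂ h1d (h1i.trans hci) hd₂d hd₂i
  have hS5 := sheet_outer c₂ d₂ h2d (h2i.trans hci) hd₂d hd₂i
  have hS6 := halves d d₂ hdd hdi hd₂d hd₂i
  have hS7 := mul_four_A d e a hdd hdi hed hei had hai
  have : KZ.of e - KZ.of a = -(KZ.of d - KZ.of e - KZ.of a) + (KZ.of d - KZ.of d₂ - KZ.of d₂)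
      - (KZ.of c₁ - KZ.of d₂) - (KZ.of c₂ - KZ.of d₂) - (KZ.of c - KZ.of c₁ - KZ.of c₂)
      + (KZ.of c - KZ.of a - KZ.of b) + (KZ.of b - KZ.of a) := by abel
  rw [this]
  refine KZ.relations.add_mem (KZ.relations.add_mem (KZ.relations.sub_mem (KZ.relations.sub_mem
    (KZ.relations.sub_mem (KZ.relations.add_mem (KZ.relations.neg_mem hS7) hS6) hS4) hS5) hS3) hS1) hS2

end ClausenPi

/-! ### The item -/

/-- **Item ClausenPiVanishes (stmt-KontsevichZagierPeriods-5202) of route K2SymbolChains.**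
`Cl₂(π) = ∫₀^π log(2 sin(φ/2)) dφ = 0` as a GENUINE instance of the Kontsevich–Zagier period
conjecture in dimension 2: the two rational representations `[{1 < u < 4t²/(1+t²)}, 1/((1+t²)u)]`
and `[{4t²/(1+t²) < u < 1}, 1/((1+t²)u)]` (positive and negative parts of the unfolded
`∫ log|1 − e^{iφ}| dφ`, `t = tan(φ/2)`, `log v = ∫₁^v du/u`) are KZ-EQUIVALENT — joined by finitely
many instances of the rules 1) additivity, 2) change of variables of [KZ 2001, §1.2] (no
Newton–Leibniz is needed). Chain: both sheets are carried by the dilation `u ↦ A(t)u`,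
`A = (1+t²)/t²`, to `[band A 4] − [band 4 A] ∼ L(4) − L(A)` (`pos_part`, `neg_part`, `exists_X_Y`),
and `L(4) ∼ L(A)` is Jensen's formula at `|α| = 1` by doubling (`ClausenPi.doubling`: product rule
`t = us`, half-turn `t ↦ −1/t`, and the two-sheeted cover `s = 2t/(1−t²)`).
[Kontsevich–Zagier 2001, §1.2; McKee–Smyth 2021, Ch. 1–2] [folklore] -/
theorem clausenPiVanishes_proof :
    Summit.KontsevichZagierPeriods.KontsevichZagierPeriods.Theses.K2SymbolChains.ClausenPiVanishes := by
  intro r r' hr hri hr' hri'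
  have hσ := K2SymbolChains.ClausenPi.isSemialgebraic_ne_zero
  have hσm : MeasurableSet {x : Fin 1 → ℝ | x 0 ≠ 0} := IsSemialgebraic.measurableSet_holds hσ
  have hi4 : IntegrableOn (fun x : Fin 1 → ℝ => 1 / (1 + x 0 ^ 2) * Real.log (4 / 1))
      {x : Fin 1 → ℝ | x 0 ≠ 0} := by
    simpa only [div_one] using
      (K2SymbolChains.ClausenPi.integrable_h.mul_const (Real.log 4)).integrableOn
  have hiA : IntegrableOn (fun x : Fin 1 → ℝ => 1 / (1 + x 0 ^ 2) *
      Real.log ((1 + x 0 ^ 2) / x 0 ^ 2 / 1)) {x : Fin 1 → ℝ | x 0 ≠ 0} := by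
    simpa only [div_one] using K2SymbolChains.ClausenPi.integrableOn_h_mul_log_A
  obtain ⟨e, hed, hei⟩ := K2SymbolChains.ClausenPi.exists_bandRep
    (g := fun x : Fin 1 → ℝ => 1 / (1 + x 0 ^ 2)) hσ
    (K2SymbolChains.ClausenPi.isSemialgebraicFunOn_one hσ)
    (K2SymbolChains.ClausenPi.isSemialgebraicFunOn_four hσ)
    (K2SymbolChains.ClausenPi.isSemialgebraicFunOn_h hσ) (fun _ _ => one_pos)
    (fun _ _ => by norm_num) hi4
  obtain ⟨a, had, hai⟩ := K2SymbolChains.ClausenPi.exists_bandRep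
    (g := fun x : Fin 1 → ℝ => 1 / (1 + x 0 ^ 2)) hσ
    (K2SymbolChains.ClausenPi.isSemialgebraicFunOn_one hσ)
    (K2SymbolChains.ClausenPi.isSemialgebraicFunOn_A hσ fun _ hx => hx)
    (K2SymbolChains.ClausenPi.isSemialgebraicFunOn_h hσ) (fun _ _ => one_pos)
    (fun _ hx => K2SymbolChains.ClausenPi.one_le_A hx) hiA
  have hD := K2SymbolChains.ClausenPi.doubling e a hed hei had hai
  obtain ⟨X, Y, hXd, hXi, hYd, hYi, hXY⟩ := K2SymbolChains.ClausenPi.exists_X_Y e a hed hei had hai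
  have hP := K2SymbolChains.ClausenPi.pos_part r X hr hri hXd hXi
  have hN := K2SymbolChains.ClausenPi.neg_part r' Y hr' hri' hYd hYi
  show KZ.of r - KZ.of r' ∈ KZ.relations
  have : KZ.of r - KZ.of r' = -(KZ.of X - KZ.of r) + (KZ.of Y - KZ.of r') + (KZ.of e - KZ.of a)
      - (KZ.of e - KZ.of a - (KZ.of X - KZ.of Y)) := by abel
  rw [this]
  exact KZ.relations.sub_mem (KZ.relations.add_mem (KZ.relations.add_mem
    (KZ.relations.neg_mem hP) hN) hD) hXY

end Summit.KontsevichZagierPeriods.K2SymbolChains
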